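import Summits.HubbardSuperconductivity.HubbardSuperconductivity.Theorems.AnisotropyChordTransferFibre3KernelWindow

/-!
# Route `AnisotropyChord` / H0 rotor rung: PORT PartN39 — HOLE₂ TAIL INPUTS: the λ-part resolvent identity and its explicit shell majorant, `1 − cos x ≤ min 2 (x²/2)`, the harmonic-support lemma, the one-hole η-identity / two-hole quasi-null identity on the torus, and the periodisation row decomposition at `λ = 0`

Port (verbatim modulo this header, the port comment, lint options, four added docstrings, and ONE announced identification)
of the theory seat's statement file `hubbard-h0-rotor-theory-1/cycle21/lean/PartN39.lean` (sha16 `082c5de712a6c18d`, v3; theory seat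
`hubbard-h0-rotor-theory-1` g21, REPORT 29–31, memo ROTOR-THEORY-21 §317, §320–§322, §327(d), §332; THEOREMS M132, M135, M137).
THE IDENTIFICATION (PORT-INDEX instruction «`RateLemma.gres/Gres/aKer` DUPLICATE PartN37's `gres/Gres/aKer` (identical bodies) — on
porting keep ONE copy (PartN37's, top namespace) and open it»): the three duplicate definitions are NOT re-declared; every
`gres`/`Gres`/`aKer` (and the typed source's `RateLemma.aKer`, `RateLemma.Gres` in `OneHoleTorus`) refers to the tree copy in
`…Fibre3KernelWindow` (PORT PartN37), whose bodies are byte-identical to the dropped ones — so every statement below is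
definitionally the typed one.  Nothing else deviates.
Statements (`def … : Prop` targets typed by the theory seat) plus the lemmas the theory file itself proves
(`one_div_sub_one_div_eq`, `one_sub_cos_le_min`, `termwise_shell`, `outer_singleton_zero`, `mem_firstShells_one`,
`card_puncturedBox_one`); no further proof claimed here (`ShellMajorant` is proved on paper by the theory seat; its four
ingredients and the periodisation identities are prover targets).
Prover seat `hubbard-h0-rotor-p2` g0; helper for stmt-HubbardSuperconductivity-19089 (`--supports`, helper class).
WHAT THIS IS NOT: nothing here proves superconductivity in the Hubbard model; the rotor TARGET as originally worded stays
FALSE (g15 verdict) — these are helper statements of ONE conditional reduction (rung 19089: GM₃ ∀L certificate, spectral input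
HOLE₂(.75), near-pair tail and far-pair skeleton defect).  `LamPartAsymptoticLaw` is a MEASURED target, `EisensteinLambert` a
classical identity NOT in Mathlib (typed as a `Prop`, not cited as a fact).  Mathlib + tree imports only; no sorry, no axioms.

Theory seat's own summary of the file:

# PartN39 — HOLE₂ TAIL INPUTS: the λ-part resolvent identity and its explicit shell majorant,
# `1 − cos x ≤ min 2 (x²/2)`, and the harmonic-support lemma behind `κ_ζ = 1/|B(ζ)|`
# (memo ROTOR-THEORY-21 §317, §320; THEOREMS M132, M135)

Context.  HOLE₂(.75) (`TwoHoleGap L (3/4·ε₁)`, PartN36) is certified per `L` for every `13 ≤ L ≤ 4096` from exact finite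
row sums (memo §319); the tail `L > 4096` is the inequality `λ_min(P_L(ζ)) ≥ m_ζ(Λ_L) − 1.07·K₀(ζ)·δ_L > 0` (memo §317(d)),
whose only analytic input is a RATE bound on the window deviation `δ_L(r) = a_L(r;λ_H) − a_∞(r)`, `λ_H = (3/2)ε₁`.
Memo §320 splits `δ_L = δ_λ + δ_per`:
* `δ_λ(r) := a_L(r;λ) − a_L(r;0) = (λ/V) Σ_{k≠0} (1 − cos k·r)/(2ε(k)(2ε(k) − λ))` — an EXACT resolvent identity
  (`LamPartIdentity`), termwise dominated by the explicit positive shell sum `S(r,L;λ)` (`LamPartShellBound`; measured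
  tightness 1.035–1.047 at `λ_H`, `L = 512`), asymptote `(3π/8)|r|² ln L/L²` (`LamPartAsymptoticLaw`, measured);
* `δ_per(r) := a_L(r;0) − a_∞(r) = −|r|²/(4V)(1 + O(|r|²/V))` — PartN37 `TorusKernelQuadraticLaw` (no logarithm).
The scalar facts `1/(a−λ) − 1/a = λ/(a(a−λ))`, `1 − cos x ≤ min 2 (x²/2)` and the termwise domination are PROVED here.
`HarmonicSupport.Statement` is the discrete-maximum-principle lemma of §317(a): for a kernel harmonic off the origin, the
solution of the boundary system on `B = outer ζ` already solves it on `ζ`; consequences (memo): `(A_∞⁻¹1)|_ζ = 0`,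
`x_B·1 = s`, `κ_ζ = lim Λ·m_ζ(Λ) = 1/|B(ζ)|` exactly, and `ker(T₀(A_∞) − ½N) = span 1_B` (the Perron identity of §314).
`RateLemma.gres/Gres/aKer` are verbatim copies of PartN37's (one copy on porting).  Mathlib + the KT1 targets layer only.
-/

-- Port of theory seat `hubbard-h0-rotor-theory-1` cycle21/lean/PartN39.lean (sha16 082c5de712a6c18d) verbatim modulo this header,
-- lint options, lint fixes, 4 docstrings and the gres/Gres/aKer identification with PORT PartN37 (…Fibre3KernelWindow);
-- prover seat `hubbard-h0-rotor-p2` g0, `--supports stmt-HubbardSuperconductivity-19089`.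

set_option linter.dupNamespace false
noncomputable section

open scoped BigOperators
open Complex

namespace Summit.HubbardSuperconductivity.HubbardSuperconductivity.Theorems.AnisotropyChord.Transfer.Fibre3

variable (L : ℕ) [NeZero L]

namespace RateLemma

-- [port] the typed source re-declares `RateLemma.gres/Gres/aKer` here (verbatim copies of PartN37's); per PORT-INDEX the
-- single tree copy is PartN37's port (`…Fibre3KernelWindow`: `gres`, `Gres`, `aKer` in the enclosing `…Fibre3` namespace),
-- which the unqualified names below resolve to.

/-- the λ-part of the window deviation, `δ_λ(r) := a_L(r;λ) − a_L(r;0)` (the zero-mode-removed resolvent is regular at `λ = 0`). -/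
def lamPart (lam2 : ℝ) (r : Tor L) : ℝ := aKer L lam2 r - aKer L 0 r

/-- the exact resolvent sum `(λ/V) Σ_{k≠0} (1 − cos k·r)/(2ε(k)(2ε(k) − λ))`. -/
def lamPartSum (lam2 : ℝ) (r : Tor L) : ℝ :=
  lam2 * (∑ k : Tor L, if k = 0 then (0 : ℝ)
      else (1 - (phase L k r).re) / ((2 * epsT L k) * (2 * epsT L k - lam2))) / (L : ℝ) ^ 2

/-- RESOLVENT DIFFERENCE IDENTITY (exact, memo §320(a)): for `0 ≤ λ < 2ε₁`, `δ_λ(r) = (λ/V)Σ_{k≠0}(1−cos k·r)/(2ε(2ε−λ))`.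
(Termwise `cos·(1/(2ε−λ) − 1/(2ε))` at `r` subtracted from the same at `0`; `2ε(k) ≥ 2ε₁ > λ` for `k ≠ 0`.) -/
def LamPartIdentity : Prop :=
  ∀ lam2 : ℝ, 0 ≤ lam2 → lam2 < 2 * eps1 L → ∀ r : Tor L, lamPart L lam2 r = lamPartSum L lam2 r

/-- the scalar identity behind `LamPartIdentity`. -/
theorem one_div_sub_one_div_eq (a lam : ℝ) (ha : a ≠ 0) (hal : a - lam ≠ 0) :
    1 / (a - lam) - 1 / a = lam / (a * (a - lam)) := by
  field_simp
  ring

/-- centred phase angle `k·r ∈ (−π, π]·(…)`: `2π·valMinAbs(k₁r₁ + k₂r₂ mod L)/L` (so that `(k·r)²/2` is a useful majorant of `1 − cos`). -/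
def kdotC (k r : Tor L) : ℝ := 2 * Real.pi * (((k.1 * r.1 + k.2 * r.2 : ZMod L).valMinAbs : ℤ) : ℝ) / L

/-- `(phase k r).re = cos(k·r)` with the centred angle (both depend on `k₁r₁ + k₂r₂ mod L` only). -/
def PhaseReCentred : Prop := ∀ k r : Tor L, (phase L k r).re = Real.cos (kdotC L k r)

/-- the explicit positive SHELL MAJORANT `S(r,L;λ) := (λ/V) Σ_{k≠0} min 2 ((k·r)²/2) / ((2ε(k))² (1 − λ/2ε(k)))`
(first shell factor `1 − λ_H/2ε₁ = 1/4` at the HOLE₂ point, `→ 1` rapidly). -/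
def shellSum (lam2 : ℝ) (r : Tor L) : ℝ :=
  lam2 * (∑ k : Tor L, if k = 0 then (0 : ℝ)
      else min 2 ((kdotC L k r) ^ 2 / 2) / ((2 * epsT L k) ^ 2 * (1 - lam2 / (2 * epsT L k)))) / (L : ℝ) ^ 2

/-- RATE LEMMA, λ-half (memo §320(c)): `0 ≤ δ_λ(r) ≤ S(r,L;λ)` for `0 ≤ λ < 2ε₁`, `4 ≤ L`
(from `LamPartIdentity`, `PhaseReCentred` and `termwise_shell`; measured `S/δ_λ ∈ [1.035, 1.047]` at `λ_H`, `L = 512`, `|r|∞ ≤ 5`). -/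
def LamPartShellBound : Prop :=
  4 ≤ L → ∀ lam2 : ℝ, 0 ≤ lam2 → lam2 < 2 * eps1 L → ∀ r : Tor L,
    0 ≤ lamPart L lam2 r ∧ lamPart L lam2 r ≤ shellSum L lam2 r

/-- `1 − cos x ≤ min 2 (x²/2)` (proved). -/
theorem one_sub_cos_le_min (x : ℝ) : 1 - Real.cos x ≤ min 2 (x ^ 2 / 2) := by
  refine le_min ?_ ?_
  · have h := Real.neg_one_le_cos x
    linarith
  · have h := Real.one_sub_sq_div_two_le_cos (x := x)
    linarith

/-- termwise domination used in `LamPartShellBound` (proved): for `0 ≤ λ < a`,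
`(1 − cos x)/(a(a−λ)) ≤ min 2 (x²/2)/(a²(1 − λ/a))`. -/
theorem termwise_shell (a lam x : ℝ) (ha : 0 < a) (hal : lam < a) :
    (1 - Real.cos x) / (a * (a - lam)) ≤ min 2 (x ^ 2 / 2) / (a ^ 2 * (1 - lam / a)) := by
  have hden : a ^ 2 * (1 - lam / a) = a * (a - lam) := by
    field_simp
  rw [hden]
  have hpos : 0 < a * (a - lam) := mul_pos ha (by linarith)
  exact div_le_div_of_nonneg_right (one_sub_cos_le_min x) hpos.le

/-- MEASURED ASYMPTOTIC LAW (memo §320(b); target, not claimed proved): at `λ_H = (3/2)ε₁`, `64 ≤ L` (checked to 4096),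
`|x|,|y| ≤ 5`: `δ_λ(x,y) ≤ (3π/8)(x² + y²)(ln L + 3)/L²`; the constant `3π/8` is the exact asymptote
(`= λ_H·(|r|²/4)·(1/V)Σ_{k≠0}1/|k|²` to leading order). -/
def LamPartAsymptoticLaw : Prop :=
  64 ≤ L → ∀ x y : ℕ, x ≤ 5 → y ≤ 5 →
    lamPart L (3 / 2 * eps1 L) ((x : ZMod L), (y : ZMod L))
      ≤ 3 * Real.pi / 8 * ((x : ℝ) ^ 2 + (y : ℝ) ^ 2) * (Real.log L + 3) / (L : ℝ) ^ 2

end RateLemma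

/-! ## The harmonic-support lemma (κ_ζ = 1/|B(ζ)|) -/

namespace HarmonicSupport

/-- the four lattice neighbours of `z ∈ ℤ²`. -/
def nbrs (z : ℤ × ℤ) : Finset (ℤ × ℤ) := {(z.1 + 1, z.2), (z.1 - 1, z.2), (z.1, z.2 + 1), (z.1, z.2 - 1)}

/-- outer vertex boundary `B(ζ) = (⋃_{z∈ζ} nbrs z) \ ζ`. -/
def outer (ζ : Finset (ℤ × ℤ)) : Finset (ℤ × ℤ) := (ζ.biUnion nbrs) \ ζ

/-- HARMONIC SUPPORT LEMMA (memo §317(a)(i)): if `a : ℤ² → ℝ` is harmonic off the origin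
(`Σ_{w ∼ z} a(w) = 4a(z)` for `z ≠ 0`) and `x` solves the boundary system `Σ_{y∈B} a(p−y) x_y = 1` for every `p ∈ B = outer ζ`,
then the same identity holds for every `p ∈ ζ`.  [Proof: `f(p) := Σ_{y∈B} a(p−y)x_y − 1` is harmonic at each `z ∈ ζ`
(`z − y ≠ 0`), vanishes on `B`, and every neighbour of `ζ` lies in `ζ ∪ B`; a finite nonempty subset of `ℤ²` is not closed
under neighbours, so the discrete maximum principle gives `max_ζ f ≤ 0 ≤ min_ζ f`.]  Consequences (memo §317): with
`A = (a(p−q))` on `ζ ∪ B`, `A(x_B ⊕ 0_ζ) = 1`, `(A⁻¹1)|_ζ = 0`, `x_B·1 = s`, `κ_ζ = 1/|B(ζ)|`, `ker(T₀ − ½N) ∋ 1_B`. -/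
def Statement : Prop :=
  ∀ a : ℤ × ℤ → ℝ, (∀ z : ℤ × ℤ, z ≠ 0 → ∑ w ∈ nbrs z, a w = 4 * a z) →
    ∀ ζ : Finset (ℤ × ℤ), ∀ x : ℤ × ℤ → ℝ,
      (∀ p ∈ outer ζ, ∑ y ∈ outer ζ, a (p - y) * x y = 1) →
        ∀ p ∈ ζ, ∑ y ∈ outer ζ, a (p - y) * x y = 1

/-- sanity: the origin's outer boundary is the cross. -/
theorem outer_singleton_zero : outer {(0, 0)} = {(1, 0), (-1, 0), (0, 1), (0, -1)} := by
  decide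

end HarmonicSupport

/-! ## PartN39 v3 addition (memo 21 §327(d)): the EXACT one-hole eigenvalue identity on the torus at the HOLE₂ point —
`Pinf(A₀(L))·1_B = η_L·1_B`, `η_L = −x_c(s − x_c)/(4s) − ε_c/(2(1+ε_c)) = −λ_H/8 + o(L⁻²)` (the finite-L defect of the ℤ² null vector;
verified to all digits, L = 32…1024). Ingredients: `(Δ + λ_H)G̃ = −δ₀ + 1/V` (so `Σ_e a(e) = 2(1+ε_c)`, `ε_c = λ_H G̃(0) − 1/V`, and
harmonicity-with-defect at `r = e`), whence `A(γδ_c + ½1_B) = (1+ε_c)δ_c` with `γ = −2 − Δa(e)/(2a(e))`. -/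

namespace OneHoleTorus

/-- the five cluster points `c, e₁, −e₁, e₂, −e₂` as torus vectors. -/
def pt (i : Fin 5) : Tor L :=
  match i with
  | 0 => (0, 0)
  | 1 => (1, 0)
  | 2 => (-1, 0)
  | 3 => (0, 1)
  | 4 => (0, -1)

/-- one-hole torus kernel matrix in WALK units (`2·aKer`) at resolvent parameter `lam2`. -/
def Amat (lam2 : ℝ) : Matrix (Fin 5) (Fin 5) ℝ :=
  Matrix.of fun i j => 2 * aKer L lam2 (pt L i - pt L j)

/-- `x = A⁻¹1`, `s = Σ x`, and `Pinf = −(A⁻¹)_BB − ½ + x_B x_Bᵀ/s` (as in PartN40, restated here over the torus data). -/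
def xv (lam2 : ℝ) : Fin 5 → ℝ := (Amat L lam2)⁻¹.mulVec (fun _ => 1)

/-- `s = Σ_i x_i` for the torus one-hole cluster. [port: docstring added.] -/
def sv (lam2 : ℝ) : ℝ := ∑ i, xv L lam2 i

/-- `Pinf = −(A⁻¹)_BB − ½ + x_B x_Bᵀ/s` over the torus data (PartN40's `oneHolePinf` shape). [port: docstring added.] -/
def Pinf (lam2 : ℝ) : Matrix (Fin 4) (Fin 4) ℝ :=
  Matrix.of fun i j => -((Amat L lam2)⁻¹) i.succ j.succ + xv L lam2 i.succ * xv L lam2 j.succ / sv L lam2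
      - (if i = j then (1 : ℝ) / 2 else 0)

/-- `ε_c = λ G̃_λ(0) − 1/V`. -/
def epsC (lam2 : ℝ) : ℝ := lam2 * Gres L lam2 0 - 1 / (L : ℝ) ^ 2

/-- `x_c = −(2ε_c − λ a(e))/(2a(e)(1+ε_c))`, `a(e) = 2·aKer(e₁)` (walk). -/
def xC (lam2 : ℝ) : ℝ :=
  -(2 * epsC L lam2 - lam2 * (2 * aKer L lam2 ((1 : ZMod L), 0)))
    / (2 * (2 * aKer L lam2 ((1 : ZMod L), 0)) * (1 + epsC L lam2))

/-- `η_L = −x_c(s − x_c)/(4s) − ε_c/(2(1+ε_c))`. -/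
def eta (lam2 : ℝ) : ℝ :=
  -(xC L lam2 * (sv L lam2 - xC L lam2)) / (4 * sv L lam2) - epsC L lam2 / (2 * (1 + epsC L lam2))

/-- ★ ONE-HOLE ETA IDENTITY (memo §327(d)): for `0 < λ < 2ε₁` (so `A` is a genuine resolvent kernel), `1_B` is an eigenvector of
`Pinf(A₀(L))` with the explicit eigenvalue `η_L(λ)`; at `λ = λ_H = (3/2)ε₁`, `η_L = −λ_H/8 + o(L⁻²)` (`−3.672e−3, −9.080e−4, −5.650e−5,
−3.530e−6` at `L = 32, 64, 256, 1024`). Also `(A⁻¹1)_c = x_c` (centre component). -/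
def EtaIdentity : Prop :=
  8 ≤ L → ∀ lam2 : ℝ, 0 < lam2 → lam2 < 2 * eps1 L →
    IsUnit (Amat L lam2).det → 1 + epsC L lam2 ≠ 0 → sv L lam2 ≠ 0 →
      xv L lam2 0 = xC L lam2 ∧
      (Pinf L lam2).mulVec (fun _ => 1) = fun _ => eta L lam2

/-- Hankel coupling matrix of the deleted pair at separation `d`: `(M_d)_{ij} = a(d − pt i − pt j)` (walk units). -/
def Mmat (lam2 : ℝ) (d : Tor L) : Matrix (Fin 5) (Fin 5) ℝ :=
  Matrix.of fun i j => 2 * aKer L lam2 (d - pt L i - pt L j)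

/-- the quasi-null test vector `v = γ δ_c + ½ 1_B`, `γ = −2 − Δa(e)/(2a(e))`, `Δa(e) = 2ε_c − λ a(e)`. -/
def gammaL (lam2 : ℝ) : ℝ :=
  -2 - (2 * epsC L lam2 - lam2 * (2 * aKer L lam2 ((1 : ZMod L), 0)))
        / (2 * (2 * aKer L lam2 ((1 : ZMod L), 0)))

/-- the quasi-null test vector `v = γ_L δ_c + ½ 1_B`. [port: docstring added.] -/
def vtest (lam2 : ℝ) : Fin 5 → ℝ := fun i => if i = 0 then gammaL L lam2 else 1 / 2

/-- ★ TWO-HOLE QUASI-NULL IDENTITY (memo 21 §332; verified to 1e−15 for d = (3,0)…antipode, L = 64, 256): for every separation `d`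
(with `d − pt i − pt j ≠ 0`, i.e. disjoint clusters), `A₀ v = (1+ε_c) δ_c` (one hole, exact) and `M_d v = ε_c · w_d`,
`(w_d)_i = 1 − a(d − pt i)/a(e)`. Consequently `(A₀ ± M_d) v = (1+ε_c)δ_c ± ε_c w_d`: the channel matrices inherit the one-hole null
structure up to a source of size `ε_c (1 + 2 a_max) = O(ln² L / L²)`, uniformly in `d` — the analytic origin of §327(a) (η ≈ −λ_H/8 in
both channels, residual ∝ 1/L²). Proof: harmonicity-with-defect `Σ_e a(r+e) − 4a(r) = 2ε_c − λ a(r)` (r ≠ 0) at `r = e` and `r = d − pt i`. -/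
def TwoHoleQuasiNull : Prop :=
  8 ≤ L → ∀ lam2 : ℝ, 0 < lam2 → lam2 < 2 * eps1 L → aKer L lam2 ((1 : ZMod L), 0) ≠ 0 →
    (Amat L lam2).mulVec (vtest L lam2) = (fun i => if i = 0 then 1 + epsC L lam2 else 0) ∧
    ∀ d : Tor L, (∀ i j : Fin 5, d - pt L i - pt L j ≠ 0) →
      (Mmat L lam2 d).mulVec (vtest L lam2) =
        fun i => epsC L lam2 * (1 - aKer L lam2 (d - pt L i) / aKer L lam2 ((1 : ZMod L), 0))

end OneHoleTorus

/-! ## PartN39 v2 additions (memo 21 §321–§322): the PROVED shell majorant with explicit constants, its four elementary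
ingredients, and the periodisation (torus − plane) row decomposition at `λ = 0`. -/

namespace RateLemma

/-- the first two shells `S₁ ∪ S₂` (nearest and diagonal neighbours of `0` in `k`-space). -/
def firstShells : Finset (Tor L) :=
  {((1 : ZMod L), 0), (-1, 0), (0, 1), (0, -1), (1, 1), (1, -1), (-1, 1), (-1, -1)}

/-- INGREDIENT 1 (shell factors, memo §321(a)(1)): for `8 ≤ L` and `k ∉ S₁ ∪ S₂ ∪ {0}`, `ε(k) ≥ 3.414 ε₁`
(`sin²(θm/2) ≥ sin²θ = 4 sin²(θ/2)cos²(θ/2) ≥ 4cos²(π/8) sin²(θ/2)` for `|m| ≥ 2`); hence the shell factor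
`(1 − λ_H/2ε(k))⁻¹ ≤ 1.2815` there, `= 4` on `S₁`, `= 8/5` on `S₂` (`ε = ε₁`, `2ε₁`). -/
def ShellFactorFar : Prop :=
  8 ≤ L → ∀ k : Tor L, k ≠ 0 → k ∉ firstShells L → (3.414 : ℝ) * eps1 L ≤ epsT L k

/-- `ε` on the first two shells (exact). -/
def FirstShellValues : Prop :=
  epsT L ((1 : ZMod L), 0) = eps1 L ∧ epsT L (0, (1 : ZMod L)) = eps1 L ∧
  epsT L ((1 : ZMod L), (1 : ZMod L)) = 2 * eps1 L ∧ epsT L ((1 : ZMod L), (-1 : ZMod L)) = 2 * eps1 L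

/-- INGREDIENT 2 (Jordan, memo §321(a)(2)): `ε(k) ≥ (2/π²) θ² |m|²` with `m` the centred representative of `k`
(`1 − cos(θv) = 2 sin²(θv/2) ≥ (2/π²)θ²v²` for `|θv/2| ≤ π/2`). -/
def JordanEpsLower : Prop :=
  ∀ k : Tor L, 2 / Real.pi ^ 2 * (2 * Real.pi / L) ^ 2 *
      ((((k.1.valMinAbs : ℤ) : ℝ)) ^ 2 + (((k.2.valMinAbs : ℤ) : ℝ)) ^ 2) ≤ epsT L k

/-- the symmetric punctured box `{m ∈ ℤ² : 0 < |m|∞ ≤ N}`. -/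
def puncturedBox (N : ℕ) : Finset (ℤ × ℤ) :=
  ((Finset.Icc (-(N : ℤ)) N) ×ˢ (Finset.Icc (-(N : ℤ)) N)).erase (0, 0)

/-- INGREDIENT 3 (rotation pairing, memo §321(a)(2)): on the rotation-symmetric box, `m ↦ m⊥ = (−m₂, m₁)` pairs
`(m·r)² + (m⊥·r)² = |m|²|r|²`, so `Σ (m·r)²/|m|⁴ = ½|r|² Σ 1/|m|²` (exact). -/
def RotationPairing : Prop :=
  ∀ N : ℕ, ∀ x y : ℤ,
    (∑ m ∈ puncturedBox N, (((m.1 * x + m.2 * y : ℤ) : ℝ)) ^ 2 / ((((m.1 ^ 2 + m.2 ^ 2 : ℤ)) : ℝ)) ^ 2)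
      = ((x : ℝ) ^ 2 + (y : ℝ) ^ 2) / 2 * ∑ m ∈ puncturedBox N, 1 / (((m.1 ^ 2 + m.2 ^ 2 : ℤ) : ℝ))

/-- INGREDIENT 4 (ring count, memo §321(a)(2)): `Σ_{0<|m|∞≤N} 1/|m|² ≤ 8(ln N + 1)` (`8n` points on the ring `|m|∞ = n`,
each with `|m| ≥ n`; `H_N ≤ ln N + 1`). -/
def RingCountBound : Prop :=
  ∀ N : ℕ, 1 ≤ N → (∑ m ∈ puncturedBox N, 1 / (((m.1 ^ 2 + m.2 ^ 2 : ℤ) : ℝ))) ≤ 8 * (Real.log N + 1)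

/-- ★ SHELL MAJORANT (PROVED on paper, memo §321(a); THEOREMS M137): for `8 ≤ L` and `0 ≤ λ ≤ λ_H = (3/2)ε₁`,
`S(r,L;λ) ≤ |r|² (11.71 ln L + 5.9)/L²` for every integer vector `r = (x,y)` (the centred product angle in `shellSum` is
`≤ θ|m₁x + m₂y|`). Assembly: `S ≤ (λ/V)[1.2815·T_all + 2.7185·T(S₁) + 0.3185·T(S₂)]`, `T_all ≤ (π⁴/(8θ²))|r|²(ln(L/2)+1)` by
Ingredients 2–4, `λ ≤ ¾θ²`, `ε₁ ≥ .4743θ²`; numerically `S/majorant ∈ [.03,.20]` (`L = 8…256`, `|r|∞ ≤ 5`). With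
`LamPartShellBound` this is the λ-half of the RATE lemma with explicit constants. -/
def ShellMajorant : Prop :=
  8 ≤ L → ∀ lam2 : ℝ, 0 ≤ lam2 → lam2 ≤ 3 / 2 * eps1 L → ∀ x y : ℤ,
    shellSum L lam2 ((x : ZMod L), (y : ZMod L))
      ≤ ((x : ℝ) ^ 2 + (y : ℝ) ^ 2) * (11.71 * Real.log L + 5.9) / (L : ℝ) ^ 2

/-! ### Periodisation at `λ = 0` (memo §322): `V(a_L − a_∞) = −y²/2 [row 0] − (π/12)(x²−y²) [kink] + (π/12 − 1/4)(x²−y²) [rings] + O(|r|⁴/L²) = −|r|²/4 + O(|r|⁴/L²)`. -/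

/-- row rapidity `μ_p`: `cosh μ_p = 2 − cos(2πp/L)` (`μ_p > 0` for `p ≢ 0`). -/
def rowMu (p : ℕ) : ℝ :=
  Real.log ((2 - Real.cos (2 * Real.pi * p / L)) + Real.sqrt ((2 - Real.cos (2 * Real.pi * p / L)) ^ 2 - 1))

/-- ring resolvent of row `p` at height `y`: `R_L(p;y) = cosh((L/2 − y)μ_p)/(2 sinh μ_p · sinh(Lμ_p/2))`, `0 ≤ y ≤ L`. -/
def ringR (p : ℕ) (y : ℝ) : ℝ :=
  Real.cosh (((L : ℝ) / 2 - y) * rowMu L p) / (2 * Real.sinh (rowMu L p) * Real.sinh ((L : ℝ) * rowMu L p / 2))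

/-- its planar limit `R_∞(p;y) = e^{−yμ_p}/(2 sinh μ_p)`. -/
def planeR (p : ℕ) (y : ℝ) : ℝ := Real.exp (-(y * rowMu L p)) / (2 * Real.sinh (rowMu L p))

/-- ZERO-ROW IDENTITY (classical): `(1/L) Σ_{k≠0} (1 − cos(2πky/L))/(2 − 2cos(2πk/L)) = y(L − y)/(2L)` for `0 ≤ y ≤ L`. -/
def ZeroRowIdentity : Prop :=
  ∀ y : ℕ, y ≤ L →
    (∑ k ∈ (Finset.range L).erase 0,
        (1 - Real.cos (2 * Real.pi * k * y / L)) / (2 - 2 * Real.cos (2 * Real.pi * k / L))) / L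
      = (y : ℝ) * ((L : ℝ) - y) / (2 * L)

/-- ROW DECOMPOSITION of the torus potential kernel at `λ = 0` (memo §322(a)):
`a_L(x,y) = (1/L)[ y(L−y)/(2L) + Σ_{p=1}^{L−1} (R_L(p;0) − cos(2πpx/L) R_L(p;y)) ]` for `0 ≤ y ≤ L`. -/
def RowDecompositionZero : Prop :=
  ∀ x y : ℕ, y ≤ L →
    aKer L 0 ((x : ZMod L), (y : ZMod L))
      = ((y : ℝ) * ((L : ℝ) - y) / (2 * L)
          + ∑ p ∈ (Finset.range L).erase 0,
              (ringR L p 0 - Real.cos (2 * Real.pi * p * x / L) * ringR L p y)) / L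

/-- RING CORRECTION IDENTITY (memo §322(a)): `R_L(p;y) − R_∞(p;y) = e^{−yμ}(e^{−Lμ} + e^{−(L−2y)μ})/((1 − e^{−Lμ}) 2 sinh μ) ≥ 0`
for `0 ≤ y ≤ L/2`, `μ = μ_p > 0` — exponentially small except for the first rows (`Lμ_p ≈ 2πp`). -/
def RingCorrectionIdentity : Prop :=
  ∀ p : ℕ, 0 < p → p < L → ∀ y : ℝ, 0 ≤ y → 2 * y ≤ L →
    ringR L p y - planeR L p y
      = Real.exp (-(y * rowMu L p)) * (Real.exp (-((L : ℝ) * rowMu L p)) + Real.exp (-(((L : ℝ) - 2 * y) * rowMu L p)))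
          / ((1 - Real.exp (-((L : ℝ) * rowMu L p))) * (2 * Real.sinh (rowMu L p)))

/-- EISENSTEIN `E₂(i) = 3/π` in Lambert form (classical; NOT in Mathlib): `Σ_{n≥1} n/(e^{2πn} − 1) = 1/24 − 1/(8π)`.
It is what makes the torus correction isotropic (`π/12 − 2π·(1/24 − 1/8π) = 1/4`); the tail needs only two-sided
geometric bounds on this sum, not the identity (checked to `1e−12`). -/
def EisensteinLambert : Prop :=
  HasSum (fun n : ℕ => ((n : ℝ) + 1) / (Real.exp (2 * Real.pi * ((n : ℝ) + 1)) - 1)) (1 / 24 - 1 / (8 * Real.pi))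

omit [NeZero L] in  -- port: lint (unused section variable)
/-- sanity: `(1,0) ∈ firstShells`. -/
theorem mem_firstShells_one : (((1 : ZMod L), (0 : ZMod L)) : Tor L) ∈ firstShells L := by
  simp [firstShells]

/-- sanity: the punctured box of radius 1 has 8 points. -/
theorem card_puncturedBox_one : (puncturedBox 1).card = 8 := by
  decide

end RateLemma

end Summit.HubbardSuperconductivity.HubbardSuperconductivity.Theorems.AnisotropyChord.Transfer.Fibre3
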